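import Literature.AlgebraicGeometry.Modules.PullbackPushforwardTraceRetraction
import Literature.Algebra.Homology.RetractOfNaturalRetraction
import Summits.HodgeConjecture.HodgeConjecture.Theorems.VHCAbelianSchemesRoadExtJumpLocusLiftsOfRetract
import Summits.HodgeConjecture.HodgeConjecture.Theorems.VHCAbelianSchemesRoadIsogenyPushforwardUnitRank
import Literature.AlgebraicGeometry.Motives.AbelianVarietyIsogenyPushforwardLocallyFreeHolds
import HarnessLib

/-!
# Road №4 (`VHCAbelianSchemesRoad`), crux stmt-HodgeConjecture-26512 `DiagLocalOfMarkmanPinnedForall` — lens line N′ «nowhere-displaceable»,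
# brick (N-F) `extJumpLocus_lifts`: JUMPS LIFT ALONG THE QUOTIENT ISOGENY `q : J × Ĵ → Y`

research route conditional on HC_CM; not a corollary; Q11.4-sentence-2 already refuted in dim ≥ 3.

FILE 2 of the req-51 plate (director-hodge g17 R17.23 (3) ∕ R17.25 (3) ∕ R17.45; LEAD 165 l.5902). THE STATEMENT is VERBATIM the line's stub (N-F)
`stub_extJumpLocus_lifts` (`Cruxes/DiagLocalOfMarkmanPinnedForall/Lines/NowhereDisplaceable.lean`, v1 c9299650b742f1b3 l.271 = v2 l.239) over the
re-homed constants of `…Theorems.VHCAbelianSchemesRoadNowhereDisplaceableDefs`: for a bounded complex of vector bundles `E•` on the secant quotient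
`Y` and `p ∈ (J × Ĵ)(ℂ)` with `q(p)` in the Ext-jump locus of `E•`, the point `p` lies in the Ext-jump locus of `q^*E•`.

PROOF = `extJumpLocus_lifts_of_retract` (p674291: the derived adjunction `Hom_{D(P)}(Q q^*M•, (Q L•)⟦k⟧) ≃ₗ[ℂ] Hom_{D(Y)}(Q M•, (Q q_*L•)⟦k⟧)`
along the affine `q`, `Modules/PullbackPushforwardDerivedAdjunction`, + `τ_p^* q^* ≅ q^* τ_{q p}^*`) fed with the input (R) it displayed, NOW PROVED:

* `exists_constRank_frames_pushforward_unit_q` — the DEGREE FRAMING of `q_*𝒪_{J×Ĵ}`: some `n ≠ 0` and, near every point of `Y`, a frame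
  `𝒪_V^I ≅ (q_*𝒪)|_V` with `#I = n` (core-qb's `exists_constRank_frames_pushforward_unit` for the non-endomorphism `q`: `q_*𝒪` is finite
  locally free by (B) `isogenyPushforwardFiniteLocallyFree_holds`, `Y` is irreducible, `q` is onto);
* **`exists_retract_pushforward_quotientPullback`** — (R): every bounded vector-bundle complex `E•` on `Y` is a retract of `q_*•q^*•E•` as a
  complex — `i = η•` (unit), `r = n⁻¹ · ρ•` with `ρ` the TRACE RETRACTION of The Stacks Project, Tag 0BVH for modules
  (`Literature/AlgebraicGeometry/Modules/PullbackPushforwardTraceRetraction`: `η_M ≫ ρ_M = n • 𝟙_M`, natural in `M`), assembled termwise by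
  `Literature/Algebra/Homology/RetractOfNaturalRetraction.exists_retract_mapHomologicalComplex`;
* **`extJumpLocus_lifts`** — (N-F).

Everything is proved; no `sorry`, no named fact, standard axioms. NOTHING here says (N-U), (S4) `stub_properJumpCarrierExists_End`, the crux, №4,
HC_AV, HC_CM or HC holds; HC_CM HELD, by name only; (N-F) is infrastructure (library debt paid), width toward the crux = 0 by R17.23's words.
References: [cite: Mukai1978, §3] [cite: MumfordAV1970, §7 Thm. 4 (p. 72)] [cite: StacksProject, Tag 0BVH and Tag 0DVC] [cite: Lipman2009, Prop. 3.2.3]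
[cite: GortzWedhorn2020, Prop. 12.13 and Prop. 12.19].
-/

noncomputable section

-- `TopCat.Presheaf`/`Scheme.Modules` are not reducible (as in Mathlib's `AlgebraicGeometry/Modules/Sheaf.lean`).
set_option backward.isDefEq.respectTransparency false

open CategoryTheory CategoryTheory.Category AlgebraicGeometry Opposite TopologicalSpace

namespace Summit.HodgeConjecture.HodgeConjecture.Ring2.SemiregularRepresentatives

set_option linter.dupNamespace false -- the cell's namespace repeats the summit name, as in every `Ring2*` file

namespace NowhereDisplaceable

open Literature.AlgebraicGeometry Literature.AlgebraicGeometry.Motives Literature.AlgebraicGeometry.Motives.AbelianVariety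
open Literature.AlgebraicGeometry.KTheory Literature.AlgebraicGeometry.Modules Literature.Algebra.Homology
open Summit.HodgeConjecture.HodgeConjecture.Ring2.SemiregularRepresentatives.MoverTrap

/-- `q_*𝒪_{J×Ĵ}` is finite locally free ((B) `isogenyPushforwardFiniteLocallyFree_holds` at `F = 𝒪`).
[cite: GortzWedhorn2020, Prop. 12.13 (p. 410) with Prop. 12.19 (p. 413)] -/
theorem isFiniteLocallyFree_pushforward_unit_q (D : SecantQuotientDatum) :
    IsFiniteLocallyFree ((Scheme.Modules.pushforward (Hom.toSchemeHom D.q)).obj (unitModule D.P.X.left)) :=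
  isogenyPushforwardFiniteLocallyFree_holds ℂ D.P D.Y D.q D.isIsogeny_q (unitModule D.P.X.left) isFiniteLocallyFree_unitModule

/-- **The degree framing of `q_*𝒪_{J×Ĵ}`**: there is `n ≠ 0` such that every point of `Y` has an open neighbourhood `V` with a frame
`𝒪_V^I ≅ (q_*𝒪)|_V`, `#I = n` (`Y` irreducible ⇒ constant frame cardinality, `card_eq_of_frames`; `n ≠ 0` since `1 ∈ Γ(q⁻¹V, 𝒪)` is a
non-zero section, `q` onto) — core-qb's `exists_constRank_frames_pushforward_unit` for the non-endomorphism `q`.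
[cite: MumfordAV1970, §7 Thm. 4 (p. 72)] [cite: StacksProject, Tag 02KA] -/
theorem exists_constRank_frames_pushforward_unit_q (D : SecantQuotientDatum) :
    ∃ n : ℕ, n ≠ 0 ∧ ∀ y : D.Y.X.left, ∃ (V : D.Y.X.left.Opens) (_ : y ∈ V) (I : Type) (_ : Fintype I)
      (_ : SheafOfModules.free I ≅ ((Scheme.Modules.pushforward (Hom.toSchemeHom D.q)).obj (unitModule D.P.X.left)).over V),
      Fintype.card I = n := by
  classical
  have hM := isFiniteLocallyFree_pushforward_unit_q D
  haveI := D.Y.irreducibleSpace_left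
  obtain ⟨y₀⟩ : Nonempty D.Y.X.left := inferInstance
  refine ⟨Fintype.card (TrivIndex hM y₀), ?_, fun y => ⟨trivNbhd hM y, mem_trivNbhd hM y, TrivIndex hM y, inferInstance,
    trivFrame hM y, ?_⟩⟩
  · intro h0
    haveI : IsEmpty (TrivIndex hM y₀) := Fintype.card_eq_zero_iff.mp h0
    haveI : Surjective (Hom.toSchemeHom D.q) := D.isIsogeny_q.1
    obtain ⟨x, hx⟩ := (Hom.toSchemeHom D.q).surjective y₀
    haveI : Nonempty ↥(Hom.toSchemeHom D.q ⁻¹ᵁ trivNbhd hM y₀) :=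
      ⟨⟨x, show (Hom.toSchemeHom D.q).base x ∈ trivNbhd hM y₀ by rw [hx]; exact mem_trivNbhd hM y₀⟩⟩
    have h1 : (show Γ((Scheme.Modules.pushforward (Hom.toSchemeHom D.q)).obj (unitModule D.P.X.left), trivNbhd hM y₀) from
        (1 : Γ(D.P.X.left, Hom.toSchemeHom D.q ⁻¹ᵁ trivNbhd hM y₀))) = 0 :=
      section_eq_zero_of_frame_isEmpty (trivFrame hM y₀) _
    have h2 : (1 : Γ(D.P.X.left, Hom.toSchemeHom D.q ⁻¹ᵁ trivNbhd hM y₀)) = 0 := h1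
    exact one_ne_zero h2
  · exact card_eq_of_frames hM ((Scheme.ΓSpecIso (CommRingCat.of ℂ)).inv ≫ D.Y.X.hom.appTop).hom (trivFrame hM y) (trivFrame hM y₀)
      (nonempty_preirreducible_inter (trivNbhd hM y).isOpen (trivNbhd hM y₀).isOpen ⟨y, mem_trivNbhd hM y⟩
        ⟨y₀, mem_trivNbhd hM y₀⟩)

/-- **(R) — EVERY BOUNDED COMPLEX OF VECTOR BUNDLES ON `Y` IS A RETRACT OF `q_*•q^*•` OF ITSELF** (as a complex): `i := η•` the unit,
`r := n⁻¹ · ρ•` the trace retraction (`Modules/PullbackPushforwardTraceRetraction`) with `n = deg q ≠ 0` (the framing above),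
`η• ≫ ρ• = n • 𝟙` termwise, assembled by `Literature.Algebra.Homology.exists_retract_mapHomologicalComplex`.
[cite: StacksProject, Tag 0BVH] [cite: MumfordAV1970, §7 Thm. 4 (p. 72)] -/
theorem exists_retract_pushforward_quotientPullback (D : SecantQuotientDatum) (E : CochainComplex D.Y.X.left.Modules ℤ)
    (hE : IsBoundedVBComplex E) :
    ∃ (i : E ⟶ ((Scheme.Modules.pushforward (Hom.toSchemeHom D.q)).mapHomologicalComplex (ComplexShape.up ℤ)).obj
        (quotientPullbackComplex D E))
      (r : ((Scheme.Modules.pushforward (Hom.toSchemeHom D.q)).mapHomologicalComplex (ComplexShape.up ℤ)).obj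
        (quotientPullbackComplex D E) ⟶ E),
      i ≫ r = 𝟙 E := by
  haveI : IsFinite (Hom.toSchemeHom D.q) := D.isIsogeny_q.2
  have h := isFiniteLocallyFree_pushforward_unit_q D
  obtain ⟨n, hn0, hn⟩ := exists_constRank_frames_pushforward_unit_q D
  have hal : ∀ X : D.Y.X.left.Modules, IsFiniteLocallyFree X → IsAffineLocalizing X := fun X hX => by
    haveI := hX.isVectorBundle.1
    exact IsAffineLocalizing.of_isQuasicoherent X
  let F := Scheme.Modules.pullback (Hom.toSchemeHom D.q) ⋙ Scheme.Modules.pushforward (Hom.toSchemeHom D.q)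
  let η : 𝟭 _ ⟶ F := (Scheme.Modules.pullbackPushforwardAdjunction (Hom.toSchemeHom D.q)).unit
  let ρ : ∀ X : D.Y.X.left.Modules, IsFiniteLocallyFree X → (F.obj X ⟶ X) := fun X hX =>
    ((n : ℂ)⁻¹) • traceRetraction (Hom.toSchemeHom D.q) h X (hal X hX)
  have hnat : ∀ {X X' : D.Y.X.left.Modules} (hX : IsFiniteLocallyFree X) (hX' : IsFiniteLocallyFree X') (φ : X ⟶ X'),
      F.map φ ≫ ρ X' hX' = ρ X hX ≫ φ := fun hX hX' φ => by
    change (Scheme.Modules.pushforward (Hom.toSchemeHom D.q)).map ((Scheme.Modules.pullback (Hom.toSchemeHom D.q)).map φ) ≫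
        ((n : ℂ)⁻¹ • traceRetraction (Hom.toSchemeHom D.q) h _ _) = ((n : ℂ)⁻¹ • traceRetraction (Hom.toSchemeHom D.q) h _ _) ≫ φ
    rw [Linear.comp_smul, Linear.smul_comp, traceRetraction_naturality]
  have hsplit : ∀ (X : D.Y.X.left.Modules) (hX : IsFiniteLocallyFree X), η.app X ≫ ρ X hX = 𝟙 X := fun X hX => by
    change pullbackUnit (Hom.toSchemeHom D.q) X ≫ ((n : ℂ)⁻¹ • traceRetraction (Hom.toSchemeHom D.q) h X (hal X hX)) = 𝟙 X
    rw [Linear.comp_smul, pullbackUnit_comp_traceRetraction (Hom.toSchemeHom D.q) h X (hal X hX) n hn,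
      ← Nat.cast_smul_eq_nsmul ℂ, smul_smul, inv_mul_cancel₀ (Nat.cast_ne_zero.mpr hn0), one_smul]
  obtain ⟨i, r, -, -, hir⟩ := exists_retract_mapHomologicalComplex F η IsFiniteLocallyFree ρ hnat hsplit E hE.isFiniteLocallyFree
  exact ⟨i, r, hir⟩

/-- **(N-F) — JUMPS LIFT ALONG `q`** (VERBATIM the line's stub `stub_extJumpLocus_lifts`, workfile `Lines/NowhereDisplaceable.lean` l.271
over `…NowhereDisplaceableDefs`): `q(p) ∈ J(E•) ⟹ p ∈ J(q^*E•)` for a bounded complex of vector bundles `E•` on `Y`. Proof: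
`extJumpLocus_lifts_of_retract` (p674291: derived adjunction along the affine `q` + the translation∕quotient pull-back iso) fed with (R)
`exists_retract_pushforward_quotientPullback` (trace retraction of Tag 0BVH). [cite: Mukai1978, §3] [cite: MumfordAV1970, §7 Thm. 4 (p. 72)]
[cite: StacksProject, Tag 0BVH and Tag 0DVC] -/
theorem extJumpLocus_lifts :
    ∀ (D : SecantQuotientDatum) (E : CochainComplex D.Y.X.left.Modules ℤ), IsBoundedVBComplex E →
      ∀ p : D.P.Points ℂ, AlgPoints.map D.q.hom.hom.hom p ∈ extJumpLocus D.Y E →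
        p ∈ extJumpLocus D.P (quotientPullbackComplex D E) :=
  extJumpLocus_lifts_of_retract exists_retract_pushforward_quotientPullback

end NowhereDisplaceable

end Summit.HodgeConjecture.HodgeConjecture.Ring2.SemiregularRepresentatives
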